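import Literature.NumberTheory.GelbartRogawski1991.DoubledUnitarySiegelParabolicAlgebra
import Literature.NumberTheory.GelbartRogawski1991.DoubledWeilRepresentationArchLagrangian
import Literature.NumberTheory.GelbartRogawski1991.DoubledUnitaryArchSiegelTwist
import Literature.NumberTheory.GelbartRogawski1991.DoubledUnitaryArchSiegelModulus
import HarnessLib

-- buildfix G11b-3 recipe (LEDGER B13-1/B13-3): elaborate sequentially so the trailing `attribute [implicit_reducible]`
-- block (reducibilityCoreExt is keyed to the async environment branch) is in force at `.olean` export.
set_option Elab.async false

/-!
# The archimedean twist and modulus on `P_Δ(L⁺ ⊗ ℝ)` of the doubled group `H = U(J^𝔻)` of the CM splitting datum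
(archimedean places of the kernel construction of [GelbartRogawski1991, Prop. 3.1.1]; [Kudla1994, §3]: the Siegel
parabolic character `χ(x(p)) |x(p)|^{1/2}`)

Topic `NumberTheory/GelbartRogawski1991`; namespace `Literature.NumberTheory.GelbartRogawski1991.GRConstruction` (the
vocabulary of `DoubledUnitaryGlobalSplittingData`: `gramR`, `hermD`, `HA`, `IsSiegelDelta`, `detDelta`, `chiDet`,
`modDelta`; `isUnit_det_gramR₀` of `DoubledWeilRepresentationArchLagrangian`).  KERNEL only: proved theorems; no new notion, no named fact, no `sorry`.

This file specialises `UnitaryDualPair.ArchSplitting` (`DoubledUnitaryArchSiegelTwist`, `DoubledUnitaryArchSiegelModulus`)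
to the doubled hermitian Gram matrix `J^𝔻 = hermD` of the CM splitting datum and reads the results in the `chiDet` ∕
`modDelta` language:

* **`exists_archDetTwist_chiDet`** — for a unitary Hecke character `χ` of `L` with `χ|_{𝕀_{L⁺}} = ε_{L/L⁺}` and any
  choice `wOf` of places of `L` over the real places of `L⁺` there is a CONTINUOUS character
  `η : H(L⁺ ⊗ ℝ) = U(J^𝔻)(L ⊗ ℝ) → ℂˣ` with, for every `g` whose archimedean idelic point `(g, 1)` lies in `P_Δ(𝔸)`,
  `η(g)² · ∏_v det(g_{w(v)})⁻¹ = χ(det_Δ (g,1))²`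
  — the `stub_S1arch_twist` shape of the stage-1 archimedean half, modulo the identification of
  `∏_v det(g_{w(v)})⁻¹` with the quotient character of Folland's normalised section (the consumer's);
* **`modDelta_archToAdelic_sq`** — `|det_Δ (g,1)|_{𝔸_L} = (modDelta (g,1))² = ∏_v ‖det_Δ(g_{w(v)})‖²`.

Nothing here is a claim of the manuscripts adjudicated by the Hodge-CM cells.

## References

* S. Gelbart, J. Rogawski, Invent. Math. 105 (1991), §3.1 Prop. 3.1.1 p. 455 [GelbartRogawski1991].
* S. S. Kudla, Israel J. Math. 87 (1994), §3 [Kudla1994].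
* A. Paul, J. Funct. Anal. 159 (1998), §1.2 (1.2.1)–(1.2.2) p. 389 [Paul1998].
-/

set_option autoImplicit false

noncomputable section

open scoped Classical
open scoped Matrix MatrixGroups ComplexConjugate
open NumberField NumberField.InfinitePlace IsDedekindDomain
open Literature.NumberTheory.Automorphic Literature.NumberTheory.Automorphic.UnitaryGroup
open Literature.RepresentationTheory.HarrisKudlaSweet1996
open Literature.NumberTheory.GaloisRepresentations

namespace Literature.NumberTheory.GelbartRogawski1991.GRConstruction

open UnitaryDualPair UnitaryDualPair.ArchSplitting

variable (L : Type) [Field L] [NumberField L] [IsCMField L]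

variable {N M n : ℕ} (e : Fin N × Fin M ≃ Fin n)
  (dV : Fin N → L) (hdV : ∀ i, IsCMField.complexConj L (dV i) = dV i) (hdV0 : ∀ i, dV i ≠ 0)
  (dW : Fin M → L) (hdW : ∀ i, IsCMField.complexConj L (dW i) = dW i) (hdW0 : ∀ i, dW i ≠ 0)
  (hc : IsCMField.complexConj L ≠ 1)
  (wOf : {v : InfinitePlace (Fp L) // v.IsReal} → {w : InfinitePlace L // w.IsComplex})
  (hw : ∀ v, IsCMField.complexConj L • (wOf v).1 = (wOf v).1)
  (hover : ∀ v, (wOf v).1.comap (algebraMap (Fp L) L) = v.1)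

/-- `J^𝔻 = hermD` IS `e₂ (T ⊕ −T) e₂ ⊗ L` for `T = gramR` (definitional). [cite: GelbartRogawski1991, §3.1 Prop. 3.1.1 p. 455 L1–2] -/
theorem hermD_eq_map_reindex_fromBlocks :
    hermD L e dV hdV dW hdW =
      (Matrix.reindex finSumFinEquiv finSumFinEquiv
          (Matrix.fromBlocks (gramR L e dV hdV dW hdW) 0 0 (-gramR L e dV hdV dW hdW))).map
        (algebraMap (Fp L) L) :=
  rfl

include hdV0 hdW0 hover in
/-- **The archimedean twist of the Siegel-parabolic character of `H = U(J^𝔻)`** in the `chiDet` language: for `χ`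
unitary with `χ|_{𝕀_{L⁺}} = ε_{L/L⁺}` there is a continuous `η : H(L⁺ ⊗ ℝ) → ℂˣ` such that for every `g` with
`(g, 1) ∈ P_Δ(𝔸)`: `η(g)² · ∏_v det(g_{w(v)})⁻¹ = χ(det_Δ (g,1))²` (`UnitaryDualPair.ArchSplitting` at `J^𝔻 = hermD`,
`u := det_Δ (g,1)` the unit of `isUnit_detDelta_of_isSiegelDelta`).
[cite: Kudla1994, §3] [cite: Paul1998, §1.2 (1.2.1)–(1.2.2) p. 389 L11–29] -/
theorem exists_archDetTwist_chiDet {χ : HeckeCharacter L} (hχu : χ.IsUnitary) (hχ : IsSplittingChar L 1 χ) :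
    ∃ η : UnitaryGroup.arch (Fp L) L (IsCMField.complexConj L) (n + n) (hermD L e dV hdV dW hdW) →* ℂˣ,
      (Continuous fun g => ((η g : ℂˣ) : ℂ)) ∧
      ∀ g : UnitaryGroup.arch (Fp L) L (IsCMField.complexConj L) (n + n) (hermD L e dV hdV dW hdW),
        IsSiegelDelta L e dV hdV dW hdW
            (UnitaryGroup.archToAdelic (Fp L) L (IsCMField.complexConj L) (n + n) (hermD L e dV hdV dW hdW) g) →
          ((η g : ℂˣ) : ℂ) ^ 2 *
              ∏ v : {v : InfinitePlace (Fp L) // v.IsReal},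
                ((((UnitaryGroup.archAt (Fp L) L (IsCMField.complexConj L) (n + n) (hermD L e dV hdV dW hdW) (wOf v)
                    (hw v) hc g : UnitaryGroup.archLocal L (n + n) (hermD L e dV hdV dW hdW) (wOf v)) :
                    GL (Fin (n + n)) ℂ) : Matrix (Fin (n + n)) (Fin (n + n)) ℂ).det)⁻¹ =
            ((chiDet L e dV hdV dW hdW χ
              (UnitaryGroup.archToAdelic (Fp L) L (IsCMField.complexConj L) (n + n) (hermD L e dV hdV dW hdW) g) :
                ℂˣ) : ℂ) ^ 2 := by
  obtain ⟨η, hηc, hη⟩ := hχ.exists_archDetTwist_doubled L (gramR L e dV hdV dW hdW)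
    (isUnit_det_gramR₀ L e dV hdV hdV0 dW hdW hdW0) (hermD L e dV hdV dW hdW)
    (hermD_eq_map_reindex_fromBlocks L e dV hdV dW hdW) hc wOf hw hover hχu
  refine ⟨η, hηc, fun g hS => ?_⟩
  have hu := isUnit_detDelta_of_isSiegelDelta L e dV hdV dW hdW _ hS
  simp only [chiDet, dif_pos hu]
  exact hη g hu.unit hS hu.unit_spec

include hover in
/-- **The modulus at an archimedean Siegel element**: `(modDelta (g,1))² = |det_Δ (g,1)|_{𝔸_L} = ∏_v ‖det_Δ(g_{w(v)})‖²`
for `(g, 1) ∈ P_Δ(𝔸)` (`UnitaryDualPair.ArchSplitting.ideleNorm_eq_prod_norm_det_deltaBlock_sq` at `J^𝔻 = hermD`).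
[cite: Kudla1994, §3] -/
theorem modDelta_archToAdelic_sq (g : UnitaryGroup.arch (Fp L) L (IsCMField.complexConj L) (n + n) (hermD L e dV hdV dW hdW))
    (hS : IsSiegelDelta L e dV hdV dW hdW
      (UnitaryGroup.archToAdelic (Fp L) L (IsCMField.complexConj L) (n + n) (hermD L e dV hdV dW hdW) g)) :
    modDelta L e dV hdV dW hdW
        (UnitaryGroup.archToAdelic (Fp L) L (IsCMField.complexConj L) (n + n) (hermD L e dV hdV dW hdW) g) ^ 2 =
      ∏ v : {v : InfinitePlace (Fp L) // v.IsReal},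
        ‖((Matrix.reindex finSumFinEquiv.symm finSumFinEquiv.symm
              (((UnitaryGroup.archAt (Fp L) L (IsCMField.complexConj L) (n + n) (hermD L e dV hdV dW hdW) (wOf v) (hw v)
                hc g : UnitaryGroup.archLocal L (n + n) (hermD L e dV hdV dW hdW) (wOf v)) : GL (Fin (n + n)) ℂ) :
                Matrix (Fin (n + n)) (Fin (n + n)) ℂ)).toBlocks₁₁ +
            (Matrix.reindex finSumFinEquiv.symm finSumFinEquiv.symm
              (((UnitaryGroup.archAt (Fp L) L (IsCMField.complexConj L) (n + n) (hermD L e dV hdV dW hdW) (wOf v) (hw v)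
                hc g : UnitaryGroup.archLocal L (n + n) (hermD L e dV hdV dW hdW) (wOf v)) : GL (Fin (n + n)) ℂ) :
                Matrix (Fin (n + n)) (Fin (n + n)) ℂ)).toBlocks₁₂).det‖ ^ 2 := by
  have hu := isUnit_detDelta_of_isSiegelDelta L e dV hdV dW hdW _ hS
  simp only [modDelta, dif_pos hu]
  have h0 : 0 ≤ ideleNorm hu.unit := by
    rw [← Literature.NumberTheory.Automorphic.coe_ideleNorm]; exact NNReal.coe_nonneg _
  rw [Real.sq_sqrt h0]
  exact ideleNorm_eq_prod_norm_det_deltaBlock_sq L (hermD L e dV hdV dW hdW) hc wOf hw hover g hu.unit hu.unit_spec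

/-! ### Build-lane note (ops-buildfix G11b-3 recipe, LEDGER B13-1, 2026-08-21)
`lean -o` (the hub build lane, never `lean`/the gate check) runs Lean 4.32's library-suggestion indexers
(`Lean.LibrarySuggestions.SymbolFrequency` / `SineQuaNon`, from their `exportEntriesFn`) over the statement of
every local theorem that is not a denied premise; on this family's statements (very large dependent binder
telescopes through the theta-kernel / dual-pair data) that fold runs for tens of minutes to hours and the build
lane kills the job (incident G11b-3, run/shared/lean/ops/buildfix/G11b-3-DOSSIER.md). `isDeniedPremise` skips
`[implicit_reducible]` constants before any fold, and a reducibility status on a *theorem* is inert (Meta never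
unfolds `thmInfo`; the kernel ignores the attribute), so the public theorems of this file are tagged
`[implicit_reducible]` purely to keep them out of that index. Only other effect: they are not offered by
`+suggestions` premise selectors. No statement or proof is changed; superseded if the operator lands a
deny-list form (`HarnessLib.PremiseIndex`). -/
set_option allowUnsafeReducibility true in
attribute [implicit_reducible]
  hermD_eq_map_reindex_fromBlocks exists_archDetTwist_chiDet modDelta_archToAdelic_sq

end Literature.NumberTheory.GelbartRogawski1991.GRConstruction

end
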